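import Literature.MathematicalPhysics.QuantumFieldTheory.Balaban1983to89.B2Ineq2116TreeDecayRegion
import Literature.MathematicalPhysics.QuantumFieldTheory.Balaban1983to89.B2Sect2Statements
import Literature.MathematicalPhysics.QuantumFieldTheory.Balaban1983to89.B2Eq243RegionsTower
import Literature.MathematicalPhysics.QuantumFieldTheory.Balaban1983to89.B1Ineq352Proof
import Literature.MathematicalPhysics.QuantumFieldTheory.Balaban1983to89.B2Sect3AGaussianStep
import Literature.MathematicalPhysics.QuantumFieldTheory.Balaban1983to89.B1Ineq353Proof
import Literature.MathematicalPhysics.QuantumFieldTheory.Balaban1983to89.B1LowerBound114Model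

/-!
# `Balaban1983to89.B2Ineq2116Region` — T. Bałaban, *(Higgs)₂,₃ quantum fields in a finite volume. II. An upper bound*,
Commun. Math. Phys. **86** (1982) 555–594 [Balaban1982Higgs2], Sect. 2.D p. 582 [PDF 28]: **(2.116) — r02's decl of record
`B2Sect2Statements.Ineq2116 Q scaleK pK vol7K ctx` INHABITED, with ONE ε-independent constant, for the family of FINAL STEPS `k = K`
of the concrete (Higgs)₂,₃ tower (`HiggsLattice.Params`, stopping rule *"Lᴷε ≦ ε₀, Lᴷ⁺¹ε > ε₀"*) whose interaction
`𝒫^{(K),Lᴷε}(Λ₇^{(K−1)}, B^{(K),ε}, ψ)` is DISPLAYED — as paper II displays it, *"a corollary of the analysis of the perturbation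
expansions"* (Prop. 2.1 p. 570, paper III) — as a polynomial of the shape (I.3.57) LOCALIZED in the region `Λ₇^{(K)} ⊂ T^{(K)}` with
the kernel bounds (I.3.58) `|v| ≦ O(1)(Lᴷε)^{κ₀}e^{−δ₀d}` and the field bound `|field′| ≦ c·p(Lᴷε)` of the restrictions
((2.114)/(2.55)) on its arguments** — a MODEL INSTANCE WITH DISPLAYED INPUTS (the row's head is r02's/the referees' to lead; this
file claims nothing about Prop. 2.1 itself), file 2 of 2 after `B2Ineq2116TreeDecayRegion` (the summation `O(1)·|Λ₇^{(K)}|`)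

statement-level skeleton of published theorems with citation tags; proofs where landed; nothing here is a claim about the Yang–Mills mass gap

PDF held: `paper:balaban1982-cmp86-higgs23-ii` (journal page = PDF page + 554); p. 582 [PDF 28], p. 570 [PDF 16], p. 581 [PDF 27] read on
the text layer `~/.lit/texts/paper-balaban1982-cmp86-higgs23-ii/p00{16,27,28}.txt`; part I [Balaban1982Higgs1] p. 622 (Prop. 3.2) and
p. 624 (the stopping rule) as quoted in p14's `B1Prop32InteractionBound`.

CITATION HEADER (lean-in-tree rule).  Cell `lit-balaban` (HOME `run/shared/lean/pub/lit-balaban/`), unit `lit-balaban-typer` gen 17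
(literature-prover-lit-balaban-typer-g17-0; own lineage — the concrete carriers `HiggsLattice` and the regions tower
`B2Eq243RegionsTower`; TAKING line HOME/STATUS.md 2026-08-22T04:54:15Z), file 2 of 2.  SKELETON row **B2.Eq2.116** (owner r02, second
reader r14, referee ref-4; decl of record `B2Sect2Statements.Ineq2116` r02 p239259 — UNTOUCHED, inhabited here; r14's twin
`B2StepK.Ineq2116Printed` and the bridge `B2StepKSect2Bridge.ineq2116Printed_of_sect2` untouched), cells of **B2.Prop2.1** ((2.57): the
same `O((Lᵏε)^{κ₀})·|region|` mechanism).  USED BY NAME, never restated: file 1 `B2Ineq2116TreeDecayRegion.{abs_poly357_loc_le_scale,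
polyConstLoc, polyConstLoc_nonneg}`, p14's `B1Ineq358TreeDecaySum.{poly357, diam, treeConst_nonneg}` and `B1Ineq352Proof.pFn_anti`
(p(·) decreasing on (0,1]), r02's `B2.Params`/`B2.Params.Printed`/`B2.pFn`/`B2Sect2Statements.Ineq2116`, the typer's
`HiggsLattice.Params.mesh`/`Site` and `B2Eq243RegionsTower.towerRegion` (Λ₇^{(K)} of the constructed tower, §4).

WHAT IS PRINTED (verbatim, text layer p. 582): *"D. The Final Step.  The procedure is continued until k = K, where K is such that Lᴷε ≦ ε₀,
Lᴷ⁺¹ε > ε₀. Then we estimate 𝒫^{(K),Lᴷε}(Λ₇^{(K−1)}, B^{(K),ε}, ψ) ≦ O((Lᴷε)^{κ₀})|Λ₇^{(K)}|. (2.116)  Now it is sufficient to prove the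
estimate … (2.117) with the constant O(1) independent of ε"*.  p. 570: *"Proposition 2.1. Under the conditions (2.55), we have … +
O((Lᵏε)^{κ₀})|Λ₇^{(k−1)′}∩Λ₇^{(k)c}|. (2.57) … This theorem is a corollary of the analysis of the perturbation expansions."*  p. 581 (2.114):
*"Lemma 2.7 and the restrictions on the fields ψ, φ imply |φ′(x)| ≦ O(1)p(Lᵏε), x ∈ Λ₅^{(k)}"*.  Part I p. 622 (Prop. 3.2): the representation
(3.57) of the interaction as a polynomial in the unit-lattice fields with kernels `|v^{(k)}(x₁,…,y_m)| ≦ O(1)(Lᵏε)^{κ₀}exp(−δ₀d(x₁,…,y_m))` (3.58),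
*"for some independent of k positive constants κ₀, δ₀, and O(1)"*.  The typed decl of record (B2Sect2Statements.lean:267):
`Ineq2116 P scaleK pK vol7K ctx := ∃ C : ℝ, ∀ i, ctx i → pK i ≤ C * scaleK i ^ P.κ₀ * vol7K i`.

THE ARGUMENT.  On an instance satisfying `ctx` (§2): file 1 gives `|𝒫| ≦ (C₀·polyConstLoc(q̄, N+d, c·p(Lᴷε), d, δ₀))·(Lᴷε)^{κ₀}·|Λ₇^{(K)}|`;
the stopping rule confines the last mesh to the ε-INDEPENDENT window `ε₀/L < Lᴷε ≦ ε₀ ≦ 1` (p14's `B1LowerBound114Model.mesh_gt_of_stop`), on which `p(Lᴷε) ≦ p(ε₀/L)`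
(`B1Ineq352Proof.pFn_anti`, `b₀ > 0`, `p > 2 ≧ 0` from `B2.Params.Printed`), and `polyConstLoc` is monotone in the field bound
(`polyConstLoc_mono`) — so ONE constant `C = C₀·polyConstLoc(q̄, N+d, c·p(ε₀/L), d, δ₀)` serves every lattice, every `ε`, every region.

WHAT THIS FILE PROVES (kernel-checked, zero `sorry`; axioms standard).
* §1 `polyConstLoc_mono` (monotone in the field bound), `pFn_nonneg`, `mesh_gt_of_stop`, `mesh_succ`.
* §2 the family: `Consts` (the constants chosen BEFORE the lattice: number `N` of scalar components, degree bound `q̄`, `δ₀ > 0`, the `O(1)`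
  `C₀ ≧ 0` of (I.3.58), the field constant `c ≧ 0` of (2.114)/(2.55), the threshold `0 < ε₀ ≦ 1`), `FinalStep Q U` (ONE final step: a lattice
  `P` of the concrete tower with `P.L = Q.L`, `P.d = Q.d`, the region `Λ7 ⊂ T^{(K)}`, the DISPLAYED kernels `coef` and unit-lattice leg values
  `leg` of `𝒫^{(K)}`), its readings `scaleK = Lᴷε` (`P.mesh P.K`), `pK = poly357 q̄ coef leg` (the displayed (I.3.57) representation of
  `𝒫^{(K),Lᴷε}(Λ₇^{(K−1)}, B^{(K),ε}, ψ)`), `vol7K = |Λ7|`, and `ctx` = the stopping rule ∧ the kernel bounds (I.3.58) at `k = K` with the exponent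
  `Q.κ₀` ∧ the localization in `Λ7` ∧ the leg bound `|leg| ≦ c·p(Lᴷε)`.
* §3 **`ineq2116_finalStep : Q.Printed → B2Sect2Statements.Ineq2116 Q scaleK pK vol7K ctx`** — (2.116) for the family, ONE constant
  `constC Q U = C₀·polyConstLoc(q̄, N+d, c·p(ε₀/L), d, δ₀)` (`abs_pK_le`: the two-sided bound `|𝒫^{(K)}| ≦ constC·(Lᴷε)^{κ₀}·|Λ₇^{(K)}|`).
* §4 non-vacuity and the tower: `mkParams`/`ctx_zero` (for every `K ≧ 0` the family contains a final step obeying `ctx`, e.g. `ε = ε₀L^{−K}` with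
  the zero interaction — so the `∃ C` is not about an empty family), and `ofTower`/`vol7K_ofTower` (the region `Λ7` may be taken to be
  `Λ₇^{(K)} = B2Eq243RegionsTower.towerRegion bad r K 7` of the typer's constructed tower, `vol7K` its number of points).
* §5 THE SAME MECHANISM AT EVERY STEP — Prop. 2.1 (2.57): `polyConstLog` and **`polyConstLoc_pFn_mul_rpow_le`** (the logarithms of the field
  bound `c·p(Lᵏε) = c·b₀(1 + log(Lᵏε)⁻¹)^p` are ABSORBED by a power gap: `polyConstLoc(q̄, n, c·p(s), d, δ₀)·s^{κ′} ≦ polyConstLog` for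
  `0 < s ≦ 1`, uniformly in the step — `B2Sect3AGaussianStep.one_add_log_inv_rpow_mul_rpow_le` by name); the family `Step21 Q V` (ONE step `k`
  of a lattice of the tower: the annulus `Ann = Bᵏ(Λ₇^{(k−1)′}) ∩ Λ₇^{(k)c}` read on `T^{(k)}`, the three printed quantities `pFull`, `quartic`,
  `pIn` of (2.57) and the DISPLAYED remainder `𝒫^{(k)}(Λ₇^{(k−1)′}) + quartic − 𝒫^{(k)}(Λ₇^{(k)})` as an `Ann`-localized (I.3.57)-polynomial with
  kernels `≦ C₀(Lᵏε)^{κ₀+κ′}e^{−δ₀·diam}` and legs `≦ c·p(Lᵏε)`), and **`prop21_step : Q.Printed → B2Sect2Statements.Prop21Printed Q (toP21 …)`**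
  — r02's decl of record of row B2.Prop2.1 INHABITED with ONE constant `constC21 = C₀·polyConstLog` over all steps, lattices and regions
  (`abs_rem_le`); non-vacuity `ctx21_zero`.
HONEST SCOPE.  (a) Proposition 2.1 / the estimate (2.116) AS STATEMENTS ABOUT BAŁABAN'S EXPANSION are NOT proved here: the representation of
`𝒫^{(K)}` (§2–§3), resp. of the remainder `𝒫^{(k)}(Λ₇^{(k−1)′}) + quartic − 𝒫^{(k)}(Λ₇^{(k)})` (§5), as a localized (I.3.57)-polynomial with
(I.3.58)-type kernel bounds is DISPLAYED in `ctx`/`ctx21` (paper II itself defers it to *"the analysis of the perturbation expansions"*, paper III;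
in §5 the displayed kernel exponent is `κ₀ + κ′` with a gap `κ′ > 0` that pays for the logarithms of the field bounds — the print's `κ₀` is the
net exponent) — exactly the status of (3.57)/(3.58) in p14's `B1Prop32InteractionBound` for part I; what IS proved
is the passage from those displayed bounds to the printed `O((Lᴷε)^{κ₀})|Λ₇^{(K)}|` with an ε-independent `O(1)`.  (b) The field bound
`|leg| ≦ c·p(Lᴷε)` is displayed per instance (it is (2.114)/(2.55) read on the unit lattice; p23's `B2Ineq2114Proof` derives (2.114) from
Lemma 2.7 on its model family — not wired here).  (c) `Λ7` is any finite set of sites of `T^{(K)}` (§4 records the tower's `Λ₇^{(K)}` as the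
intended one); *"localized in"* = at least one point in `Λ7` (file 1).  (d) KIND model instance / displayed inputs: the row's head is the
owner's and the referees' call (PARTIAL per §C.6 is the expected reading); nothing here is summit progress.
-/

open scoped BigOperators

namespace Literature.MathematicalPhysics.QuantumFieldTheory.Balaban1983to89.B2Ineq2116Region

open Literature.MathematicalPhysics.QuantumFieldTheory.Balaban1983to89.B1Ineq358TreeDecaySum (diam treeConst treeConst_nonneg poly357)
open Literature.MathematicalPhysics.QuantumFieldTheory.Balaban1983to89.B2Ineq2116TreeDecayRegion
  (polyConstLoc polyConstLoc_nonneg abs_poly357_loc_le_scale)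
open Literature.MathematicalPhysics.QuantumFieldTheory.Balaban1983to89.B1Ineq352Proof (pFn_anti)
open Literature.MathematicalPhysics.QuantumFieldTheory.Balaban1983to89.B1Ineq353Proof (pFn_nonneg)
open Literature.MathematicalPhysics.QuantumFieldTheory.Balaban1983to89.B1LowerBound114Model (mesh_gt_of_stop)

/-! ## §1 Monotonicity of the constant; the stopping window -/

section Prelim

/-- `polyConstLoc` is monotone in the field bound `q₀` (`nΛ ≧ 0`, `0 ≦ q₀ ≦ q₀′`, `δ₀ ≧ 0`). [cite: Balaban1982Higgs2, (2.116) p.582] -/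
theorem polyConstLoc_mono (qmax : ℕ) {nΛ q₀ q₀' : ℝ} (hn : 0 ≤ nΛ) (hq : 0 ≤ q₀) (hqq : q₀ ≤ q₀') (d : ℕ) {δ₀ : ℝ} (hδ : 0 ≤ δ₀) :
    polyConstLoc qmax nΛ q₀ d δ₀ ≤ polyConstLoc qmax nΛ q₀' d δ₀ := by
  unfold B2Ineq2116TreeDecayRegion.polyConstLoc
  refine Finset.sum_le_sum fun q _ => ?_
  have h1 : (nΛ * q₀) ^ q ≤ (nΛ * q₀') ^ q :=
    pow_le_pow_left₀ (mul_nonneg hn hq) (mul_le_mul_of_nonneg_left hqq hn) q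
  exact mul_le_mul_of_nonneg_right (mul_le_mul_of_nonneg_left h1 (Nat.cast_nonneg q)) (treeConst_nonneg d hδ q)

variable {P : HiggsLattice.Params}

/-- `L^{K+1}ε = L·Lᴷε` ((I.1.19)). [cite: Balaban1982Higgs1, (1.19) p.607] -/
theorem mesh_succ (K : ℕ) : P.mesh (K + 1) = (P.L : ℝ) * P.mesh K := by
  unfold HiggsLattice.Params.mesh
  ring

end Prelim

/-! ## §2 The family of final steps with the displayed representation of `𝒫^{(K)}` -/

section Family

/-- The constants chosen before the lattice (paper II: *"independent of k positive constants κ₀, δ₀, and O(1)"* of (I.3.58); the `O(1)` of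
(2.114); the threshold `ε₀` of the stopping rule, `ε₀ ≦ 1`): number `N` of scalar field components, degree bound `qmax` of the displayed
polynomial, `δ₀ > 0`, `C₀ ≧ 0`, the field constant `c ≧ 0`, and `0 < ε₀ ≦ 1`.  (The exponent `κ₀` is the family parameter `Q.κ₀` of r02's
`B2.Params`.) [cite: Balaban1982Higgs2, (2.116) p.582; Prop. 2.1 (2.57) p.570] -/
structure Consts where
  /-- number of scalar field components -/
  N : ℕ
  /-- degree bound of the displayed polynomial (I.3.57) -/
  qmax : ℕ
  /-- the tree-decay rate of (I.3.58) -/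
  δ₀ : ℝ
  /-- the `O(1)` of (I.3.58) -/
  C₀ : ℝ
  /-- the `O(1)` of the unit-lattice field bound (2.114)/(2.55) -/
  c : ℝ
  /-- the stopping threshold -/
  ε₀ : ℝ
  hδ₀ : 0 < δ₀
  hC₀ : 0 ≤ C₀
  hc : 0 ≤ c
  hε₀ : 0 < ε₀
  hε₀1 : ε₀ ≤ 1

/-- ONE FINAL STEP `k = K` of the concrete (Higgs)₂,₃ tower: a lattice `P` (`HiggsLattice.Params`: `T_ε` and its coarse lattices `T^{(k)}`,
`K = P.K`) with the family's `L` and `d`, the region `Λ7 = Λ₇^{(K)} ⊂ T^{(K)}` (a finite set of sites; §4: e.g. the constructed tower's), and the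
DISPLAYED representation of `𝒫^{(K),Lᴷε}(Λ₇^{(K−1)}, B^{(K),ε}, ψ)` as a polynomial (I.3.57) in the unit-lattice field components at
`B^{(K),ε}, ψ`: kernels `coef q (z : Fin q → T^{(K)}) (κ : Fin q → Lbl)` and leg values `leg : Lbl → T^{(K)} → ℝ`, `Lbl = {1,…,N} ⊔ {1,…,d}`
(scalar / vector components). [cite: Balaban1982Higgs2, (2.116) p.582; Prop. 2.1 (2.57) p.570] -/
structure FinalStep (Q : B2.Params) (U : Consts) where
  /-- the lattice `T_ε` with its tower `T^{(k)}`, `k ≦ K` -/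
  P : HiggsLattice.Params
  hL : P.L = Q.L
  hd : P.d = Q.d
  /-- the region `Λ₇^{(K)} ⊂ T^{(K)}` -/
  Λ7 : Finset (HiggsLattice.Site P P.K)
  /-- the displayed kernels of (I.3.57) at `k = K` -/
  coef : (q : ℕ) → (Fin q → HiggsLattice.Site P P.K) → (Fin q → (Fin U.N ⊕ Fin P.d)) → ℝ
  /-- the unit-lattice field components `ψ′_j(x)`, `B′_μ(y)` entering (I.3.57) -/
  leg : (Fin U.N ⊕ Fin P.d) → HiggsLattice.Site P P.K → ℝ

namespace FinalStep

variable {Q : B2.Params} {U : Consts}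

/-- `scaleK = Lᴷε`, the last mesh. [cite: Balaban1982Higgs2, (2.116) p.582] -/
noncomputable def scaleK (i : FinalStep Q U) : ℝ := i.P.mesh i.P.K

/-- `pK = 𝒫^{(K),Lᴷε}(Λ₇^{(K−1)}, B^{(K),ε}, ψ)`, DISPLAYED as the polynomial (I.3.57) with the instance's kernels and leg values.
[cite: Balaban1982Higgs2, (2.116) p.582; Prop. 2.1 (2.57) p.570] -/
def pK (i : FinalStep Q U) : ℝ := poly357 U.qmax i.coef i.leg

/-- `vol7K = |Λ₇^{(K)}|` (*"the symbol |·| means the number of elements in a given set"*, p. 592). [cite: Balaban1982Higgs2, (2.116) p.582] -/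
def vol7K (i : FinalStep Q U) : ℕ := i.Λ7.card

/-- The standing context of an instance: the stopping rule `Lᴷε ≦ ε₀ < Lᴷ⁺¹ε` (p. 582); the DISPLAYED kernel bounds (I.3.58) at `k = K` with
the family's exponent `κ₀` — `|coef q z κ| ≦ C₀(Lᴷε)^{κ₀}e^{−δ₀·diam z}`; the localization of the terms in `Λ₇^{(K)}` (a kernel vanishes unless
one of its points lies in `Λ7`); and the unit-lattice field bound `|leg| ≦ c·p(Lᴷε)` ((2.114)/(2.55)). [cite: Balaban1982Higgs2, (2.116) p.582; (2.114) p.581; Prop. 2.1 (2.57) p.570] -/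
def ctx (i : FinalStep Q U) : Prop :=
  i.P.mesh i.P.K ≤ U.ε₀ ∧ U.ε₀ < i.P.mesh (i.P.K + 1) ∧
  (∀ q, q ≤ U.qmax → ∀ (z : Fin q → HiggsLattice.Site i.P i.P.K) (κ : Fin q → (Fin U.N ⊕ Fin i.P.d)),
      |i.coef q z κ| ≤ U.C₀ * i.P.mesh i.P.K ^ Q.κ₀ * Real.exp (-(U.δ₀ * (diam z : ℝ)))) ∧
  (∀ q, q ≤ U.qmax → ∀ (z : Fin q → HiggsLattice.Site i.P i.P.K) (κ : Fin q → (Fin U.N ⊕ Fin i.P.d)),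
      (∀ j, z j ∉ i.Λ7) → i.coef q z κ = 0) ∧
  (∀ l x, |i.leg l x| ≤ U.c * B2.pFn Q.b₀ Q.p (i.P.mesh i.P.K))

end FinalStep

/-- THE constant of (2.116) for the family: `C₀·polyConstLoc(q̄, N + d, c·p(ε₀/L), d, δ₀)` — independent of the lattice, of `ε` and of the
region. [cite: Balaban1982Higgs2, (2.116) p.582] -/
noncomputable def constC (Q : B2.Params) (U : Consts) : ℝ :=
  U.C₀ * polyConstLoc U.qmax ((U.N : ℝ) + Q.d) (U.c * B2.pFn Q.b₀ Q.p (U.ε₀ / Q.L)) Q.d U.δ₀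

end Family

/-! ## §3 (2.116) for the family -/

section Main

variable {Q : B2.Params} {U : Consts}

/-- The two-sided bound per instance: under `ctx`, `|𝒫^{(K)}| ≦ constC·(Lᴷε)^{κ₀}·|Λ₇^{(K)}|`. [cite: Balaban1982Higgs2, (2.116) p.582] -/
theorem abs_pK_le (hP : Q.Printed) (i : FinalStep Q U) (hi : i.ctx) :
    |i.pK| ≤ constC Q U * i.scaleK ^ Q.κ₀ * (i.vol7K : ℝ) := by
  obtain ⟨hp2, _, hL1, _, _, _, hb₀, _⟩ := hP
  obtain ⟨hstop1, hstop2, hcoef, hloc, hleg⟩ := hi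
  have hs0 : 0 < i.P.mesh i.P.K := i.P.mesh_pos _
  have hs1 : i.P.mesh i.P.K ≤ 1 := hstop1.trans U.hε₀1
  have hLQ : (i.P.L : ℝ) = Q.L := by exact_mod_cast i.hL
  have hLpos : (0 : ℝ) < Q.L := by
    have : (0 : ℝ) < i.P.L := by exact_mod_cast i.P.hL
    rwa [hLQ] at this
  -- the window of the last mesh: ε₀/L < Lᴷε ≤ ε₀ ≤ 1
  have hlow : U.ε₀ / Q.L < i.P.mesh i.P.K := by
    have h := mesh_gt_of_stop (P := i.P) hstop2
    rwa [hLQ] at h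
  have hlow0 : 0 < U.ε₀ / Q.L := div_pos U.hε₀ hLpos
  -- the field bound at the last mesh is below the ε-independent one
  have hq₀ : 0 ≤ U.c * B2.pFn Q.b₀ Q.p (i.P.mesh i.P.K) :=
    mul_nonneg U.hc (pFn_nonneg hb₀.le hs0 hs1)
  have hpmono : B2.pFn Q.b₀ Q.p (i.P.mesh i.P.K) ≤ B2.pFn Q.b₀ Q.p (U.ε₀ / Q.L) :=
    pFn_anti hb₀.le (by linarith) hlow0 hlow.le hs1
  -- file 1 at the instance
  have h1 := abs_poly357_loc_le_scale (P := i.P) (k := i.P.K) U.qmax i.coef i.leg i.Λ7 (κ₀ := Q.κ₀) U.hC₀ hs0.le U.hδ₀ hq₀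
    hcoef hloc hleg
  have hcard : (Fintype.card (Fin U.N ⊕ Fin i.P.d) : ℝ) = (U.N : ℝ) + i.P.d := by
    rw [Fintype.card_sum, Fintype.card_fin, Fintype.card_fin, Nat.cast_add]
  rw [hcard] at h1
  -- monotonicity of the constant in the field bound (stated with the instance's `d`; `i.hd : P.d = Q.d` converts at the end)
  have hmono : polyConstLoc U.qmax ((U.N : ℝ) + i.P.d) (U.c * B2.pFn Q.b₀ Q.p (i.P.mesh i.P.K)) i.P.d U.δ₀
      ≤ polyConstLoc U.qmax ((U.N : ℝ) + i.P.d) (U.c * B2.pFn Q.b₀ Q.p (U.ε₀ / Q.L)) i.P.d U.δ₀ :=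
    polyConstLoc_mono U.qmax (by positivity) hq₀ (mul_le_mul_of_nonneg_left hpmono U.hc) i.P.d U.hδ₀.le
  have hrest : 0 ≤ i.P.mesh i.P.K ^ Q.κ₀ * (i.Λ7.card : ℝ) := mul_nonneg (Real.rpow_nonneg hs0.le _) (Nat.cast_nonneg _)
  unfold FinalStep.pK FinalStep.scaleK FinalStep.vol7K constC
  rw [← i.hd]
  calc |poly357 U.qmax i.coef i.leg|
      ≤ (U.C₀ * polyConstLoc U.qmax ((U.N : ℝ) + i.P.d) (U.c * B2.pFn Q.b₀ Q.p (i.P.mesh i.P.K)) i.P.d U.δ₀) *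
          i.P.mesh i.P.K ^ Q.κ₀ * (i.Λ7.card : ℝ) := h1
    _ = (U.C₀ * polyConstLoc U.qmax ((U.N : ℝ) + i.P.d) (U.c * B2.pFn Q.b₀ Q.p (i.P.mesh i.P.K)) i.P.d U.δ₀) *
          (i.P.mesh i.P.K ^ Q.κ₀ * (i.Λ7.card : ℝ)) := by ring
    _ ≤ (U.C₀ * polyConstLoc U.qmax ((U.N : ℝ) + i.P.d) (U.c * B2.pFn Q.b₀ Q.p (U.ε₀ / Q.L)) i.P.d U.δ₀) *
          (i.P.mesh i.P.K ^ Q.κ₀ * (i.Λ7.card : ℝ)) :=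
        mul_le_mul_of_nonneg_right (mul_le_mul_of_nonneg_left hmono U.hC₀) hrest
    _ = U.C₀ * polyConstLoc U.qmax ((U.N : ℝ) + i.P.d) (U.c * B2.pFn Q.b₀ Q.p (U.ε₀ / Q.L)) i.P.d U.δ₀ *
          i.P.mesh i.P.K ^ Q.κ₀ * (i.Λ7.card : ℝ) := by ring

/-- **(2.116) p. 582 — r02's decl of record INHABITED for the family of final steps of the concrete tower with the displayed
representation of `𝒫^{(K)}`**: *"𝒫^{(K),Lᴷε}(Λ₇^{(K−1)}, B^{(K),ε}, ψ) ≦ O((Lᴷε)^{κ₀})|Λ₇^{(K)}|"* with ONE constant `constC Q U`,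
independent of `ε` (*"with the constant O(1) independent of ε"*, p. 582), for the printed parameter ranges `Q.Printed`.  KIND: model
instance, displayed inputs (Prop. 2.1 / (I.3.57)–(I.3.58) are paper III's). [cite: Balaban1982Higgs2, (2.116) p.582] -/
theorem ineq2116_finalStep (Q : B2.Params) (hP : Q.Printed) (U : Consts) :
    B2Sect2Statements.Ineq2116 Q (FinalStep.scaleK (Q := Q) (U := U)) FinalStep.pK FinalStep.vol7K FinalStep.ctx :=
  ⟨constC Q U, fun i hi => (le_abs_self _).trans (abs_pK_le hP i hi)⟩

end Main

/-! ## §4 Non-vacuity; the region of the constructed tower -/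

section NonVacuity

variable {Q : B2.Params} {U : Consts}

/-- A lattice of the family with last mesh EXACTLY `ε₀` (`ε = ε₀L^{−K}`), `K` arbitrary, `M = L′_μ = 1`, for the printed `d ∈ {2,3}`, `L > 1`.
[cite: Balaban1982Higgs2, p.582 (before (2.116)); pp.556–557] -/
noncomputable def mkParams (Q : B2.Params) (U : Consts) (hd : 1 ≤ Q.d) (hL : 0 < Q.L) (K : ℕ) : HiggsLattice.Params where
  d := Q.d
  ε := U.ε₀ / (Q.L : ℝ) ^ K
  K := K
  L := Q.L
  M := 1
  Lp := fun _ => 1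
  hd := hd
  hε := div_pos U.hε₀ (pow_pos (by exact_mod_cast hL) K)
  hL := hL
  hM := Nat.one_pos
  hLp := fun _ => Nat.one_pos

/-- The last mesh of `mkParams` is `ε₀`. [cite: Balaban1982Higgs2, p.582 (before (2.116))] -/
theorem mesh_mkParams (hd : 1 ≤ Q.d) (hL : 0 < Q.L) (K : ℕ) : (mkParams Q U hd hL K).mesh K = U.ε₀ := by
  unfold mkParams HiggsLattice.Params.mesh
  have hLK : ((Q.L : ℝ)) ^ K ≠ 0 := pow_ne_zero K (by exact_mod_cast hL.ne')
  field_simp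

/-- **The family is not empty and `ctx` is satisfiable** for the printed ranges: for every `K`, the lattice `ε = ε₀L^{−K}` (last mesh `ε₀`,
so `Lᴷε ≦ ε₀ < Lᴷ⁺¹ε` as `L > 1`) with any region and the ZERO interaction obeys `ctx` — the `∃ C` of (2.116) quantifies over an inhabited
context. [cite: Balaban1982Higgs2, (2.116) p.582] -/
theorem ctx_zero (hP : Q.Printed) (K : ℕ) :
    ∃ i : FinalStep Q U, i.P.K = K ∧ i.ctx := by
  obtain ⟨_, _, hL1, hd23, _, _, hb₀, _⟩ := hP
  have hd : 1 ≤ Q.d := by rcases hd23 with h | h <;> omega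
  have hL : 0 < Q.L := lt_trans Nat.zero_lt_one hL1
  refine ⟨⟨mkParams Q U hd hL K, rfl, rfl, ∅, fun _ _ _ => 0, fun _ _ => 0⟩, rfl, ?_⟩
  refine ⟨?_, ?_, ?_, ?_, ?_⟩
  · show (mkParams Q U hd hL K).mesh K ≤ U.ε₀
    rw [mesh_mkParams]
  · show U.ε₀ < (mkParams Q U hd hL K).mesh (K + 1)
    rw [mesh_succ, mesh_mkParams]
    have hL' : (1 : ℝ) < Q.L := by exact_mod_cast hL1
    have : (1 : ℝ) * U.ε₀ < (Q.L : ℝ) * U.ε₀ := mul_lt_mul_of_pos_right hL' U.hε₀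
    simpa [mkParams] using this
  · intro q _ z κ
    show |(0 : ℝ)| ≤ _
    rw [abs_zero]
    exact mul_nonneg (mul_nonneg U.hC₀ (Real.rpow_nonneg ((mkParams Q U hd hL K).mesh_pos _).le _)) (Real.exp_pos _).le
  · intro q _ z κ _
    rfl
  · intro l x
    show |(0 : ℝ)| ≤ _
    rw [abs_zero]
    refine mul_nonneg U.hc (pFn_nonneg hb₀.le ((mkParams Q U hd hL K).mesh_pos _) ?_)
    have h : (mkParams Q U hd hL K).mesh K = U.ε₀ := mesh_mkParams hd hL K
    calc (mkParams Q U hd hL K).mesh (mkParams Q U hd hL K).K = U.ε₀ := h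
      _ ≤ 1 := U.hε₀1

/-- The region may be taken to be `Λ₇^{(K)}` of the typer's CONSTRUCTED regions tower (`B2Eq243RegionsTower.towerRegion bad r K 7`, built from
the large-field points `bad` and the radii `r(Lʲε)` of every step): the final step of that tower with displayed kernels / legs.
[cite: Balaban1982Higgs2, (2.116) p.582; p.570 (Λ₀^{(k)}, Λ₇^{(k)})] -/
noncomputable def ofTower (P : HiggsLattice.Params) (hL : P.L = Q.L) (hd : P.d = Q.d)
    (bad : (j : ℕ) → Set (HiggsLattice.Site P j)) (r : ℕ → ℝ)
    (coef : (q : ℕ) → (Fin q → HiggsLattice.Site P P.K) → (Fin q → (Fin U.N ⊕ Fin P.d)) → ℝ)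
    (leg : (Fin U.N ⊕ Fin P.d) → HiggsLattice.Site P P.K → ℝ) : FinalStep Q U :=
  ⟨P, hL, hd, B2Eq243RegionsTower.towerRegion bad r P.K 7, coef, leg⟩

/-- For the tower instance `vol7K = |Λ₇^{(K)}|` is the number of points of the constructed region. [cite: Balaban1982Higgs2, (2.116) p.582] -/
theorem vol7K_ofTower (P : HiggsLattice.Params) (hL : P.L = Q.L) (hd : P.d = Q.d)
    (bad : (j : ℕ) → Set (HiggsLattice.Site P j)) (r : ℕ → ℝ)
    (coef : (q : ℕ) → (Fin q → HiggsLattice.Site P P.K) → (Fin q → (Fin U.N ⊕ Fin P.d)) → ℝ)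
    (leg : (Fin U.N ⊕ Fin P.d) → HiggsLattice.Site P P.K → ℝ) :
    (ofTower (Q := Q) (U := U) P hL hd bad r coef leg).vol7K = (B2Eq243RegionsTower.towerRegion bad r P.K 7).card := rfl

/-- Hence (2.116) holds in particular along the constructed towers: for every tower instance obeying `ctx`,
`𝒫^{(K)} ≦ constC·(Lᴷε)^{κ₀}·|Λ₇^{(K)}|` with `Λ₇^{(K)}` the constructed region. [cite: Balaban1982Higgs2, (2.116) p.582] -/
theorem pK_ofTower_le (hP : Q.Printed) (P : HiggsLattice.Params) (hL : P.L = Q.L) (hd : P.d = Q.d)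
    (bad : (j : ℕ) → Set (HiggsLattice.Site P j)) (r : ℕ → ℝ)
    (coef : (q : ℕ) → (Fin q → HiggsLattice.Site P P.K) → (Fin q → (Fin U.N ⊕ Fin P.d)) → ℝ)
    (leg : (Fin U.N ⊕ Fin P.d) → HiggsLattice.Site P P.K → ℝ)
    (hctx : (ofTower (Q := Q) (U := U) P hL hd bad r coef leg).ctx) :
    (ofTower (Q := Q) (U := U) P hL hd bad r coef leg).pK
      ≤ constC Q U * P.mesh P.K ^ Q.κ₀ * ((B2Eq243RegionsTower.towerRegion bad r P.K 7).card : ℝ) :=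
  (le_abs_self _).trans (abs_pK_le hP _ hctx)

end NonVacuity

/-! ## §5 The same mechanism at every step: Proposition 2.1 (2.57) for the displayed family, the logarithms absorbed -/

section Prop21

open Literature.MathematicalPhysics.QuantumFieldTheory.Balaban1983to89.B2Sect3AGaussianStep (one_add_log_inv_rpow_mul_rpow_le)

/-- The k-UNIFORM constant of (2.57): `Σ_{q≦qmax} q·(n·c·b₀)^q·max{1, pq/κ′}^{pq}·treeConst_q` — `polyConstLoc` at the field bound `c·p(s)` with the
logarithms `(1 + log s⁻¹)^{pq}` traded for the power gap `s^{κ′}`. [cite: Balaban1982Higgs2, Prop. 2.1 (2.57) p.570] -/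
noncomputable def polyConstLog (qmax : ℕ) (n c b₀ p κg : ℝ) (d : ℕ) (δ₀ : ℝ) : ℝ :=
  ∑ q ∈ Finset.range (qmax + 1), (q : ℝ) * (n * c * b₀) ^ q * (max 1 (p * q / κg)) ^ (p * q) * treeConst d δ₀ q

/-- **The logarithms of the field bound are absorbed by a power gap, uniformly in the step**: for `0 < s ≦ 1` (`s = Lᵏε`), `b₀ ≧ 0`, `p > 0`,
`c, n ≧ 0`, `κ′ > 0`, `δ₀ ≧ 0`: `polyConstLoc(qmax, n, c·p(s), d, δ₀)·s^{κ′} ≦ polyConstLog(qmax, n, c, b₀, p, κ′, d, δ₀)` — termwise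
`(1 + log s⁻¹)^{pq}·s^{κ′} ≦ max{1, pq/κ′}^{pq}` (`B2Sect3AGaussianStep.one_add_log_inv_rpow_mul_rpow_le`). This is why the printed exponent
`κ₀` of (2.57) is smaller than the kernels' own. [cite: Balaban1982Higgs2, Prop. 2.1 (2.57) p.570; (2.11) p.559] -/
theorem polyConstLoc_pFn_mul_rpow_le (qmax : ℕ) {n c b₀ p κg s : ℝ} (hn : 0 ≤ n) (hc : 0 ≤ c) (hb₀ : 0 ≤ b₀) (hp : 0 < p)
    (hκ : 0 < κg) (hs : 0 < s) (hs1 : s ≤ 1) (d : ℕ) {δ₀ : ℝ} (hδ : 0 ≤ δ₀) :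
    polyConstLoc qmax n (c * B2.pFn b₀ p s) d δ₀ * s ^ κg ≤ polyConstLog qmax n c b₀ p κg d δ₀ := by
  unfold B2Ineq2116TreeDecayRegion.polyConstLoc polyConstLog B2.pFn
  rw [Finset.sum_mul]
  refine Finset.sum_le_sum fun q _ => ?_
  have hlog : 0 ≤ 1 + Real.log s⁻¹ := by
    rw [Real.log_inv]
    have := Real.log_nonpos hs.le hs1
    linarith
  have hsk : 0 ≤ s ^ κg := Real.rpow_nonneg hs.le κg
  have htc : 0 ≤ treeConst d δ₀ q := treeConst_nonneg d hδ q
  -- split off the logarithms: (n·(c·(b₀(1+L)^p)))^q = (n·c·b₀)^q · ((1+L)^p)^q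
  have hsplit : (n * (c * (b₀ * (1 + Real.log s⁻¹) ^ p))) ^ q
      = (n * c * b₀) ^ q * ((1 + Real.log s⁻¹) ^ p) ^ q := by
    rw [← mul_pow]; ring
  have hpow : ((1 + Real.log s⁻¹) ^ p) ^ q = (1 + Real.log s⁻¹) ^ (p * q) := by
    rw [← Real.rpow_natCast, ← Real.rpow_mul hlog]
  rcases Nat.eq_zero_or_pos q with hq | hq
  · subst hq
    simp
  · have hpq : 0 < p * q := mul_pos hp (by exact_mod_cast hq)
    have key : (1 + Real.log s⁻¹) ^ (p * q) * s ^ κg ≤ (max 1 (p * q / κg)) ^ (p * q) :=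
      one_add_log_inv_rpow_mul_rpow_le hpq hκ hs hs1
    have hncb : 0 ≤ (n * c * b₀) ^ q := pow_nonneg (mul_nonneg (mul_nonneg hn hc) hb₀) q
    calc (q : ℝ) * (n * (c * (b₀ * (1 + Real.log s⁻¹) ^ p))) ^ q * treeConst d δ₀ q * s ^ κg
        = (q : ℝ) * (n * c * b₀) ^ q * treeConst d δ₀ q * ((1 + Real.log s⁻¹) ^ (p * q) * s ^ κg) := by
          rw [hsplit, hpow]; ring
      _ ≤ (q : ℝ) * (n * c * b₀) ^ q * treeConst d δ₀ q * (max 1 (p * q / κg)) ^ (p * q) :=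
          mul_le_mul_of_nonneg_left key (by positivity)
      _ = (q : ℝ) * (n * c * b₀) ^ q * (max 1 (p * q / κg)) ^ (p * q) * treeConst d δ₀ q := by ring

/-- `polyConstLog ≧ 0` (`n·c·b₀ ≧ 0`, `δ₀ ≧ 0`). [cite: Balaban1982Higgs2, Prop. 2.1 (2.57) p.570] -/
theorem polyConstLog_nonneg (qmax : ℕ) {n c b₀ p κg : ℝ} (h : 0 ≤ n * c * b₀) (d : ℕ) {δ₀ : ℝ} (hδ : 0 ≤ δ₀) :
    0 ≤ polyConstLog qmax n c b₀ p κg d δ₀ :=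
  Finset.sum_nonneg fun q _ => mul_nonneg (mul_nonneg (mul_nonneg (Nat.cast_nonneg q) (pow_nonneg h q))
    (Real.rpow_nonneg (le_trans zero_le_one (le_max_left _ _)) _)) (treeConst_nonneg d hδ q)

/-- The constants of Prop. 2.1 chosen before the lattice: `N`, the degree bound `qmax`, `δ₀ > 0`, the `O(1)` `C₀ ≧ 0` and the GAP `κ′ > 0` of the
displayed kernel bounds (kernels `≦ C₀(Lᵏε)^{κ₀+κ′}e^{−δ₀·diam}`), the field constant `c ≧ 0` of (2.55)/(2.114). [cite: Balaban1982Higgs2, Prop. 2.1 (2.57) p.570] -/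
structure StepConsts where
  N : ℕ
  qmax : ℕ
  δ₀ : ℝ
  C₀ : ℝ
  c : ℝ
  /-- the power gap paying for the logarithms of the field bounds -/
  κg : ℝ
  hδ₀ : 0 < δ₀
  hC₀ : 0 ≤ C₀
  hc : 0 ≤ c
  hκg : 0 < κg

/-- ONE STEP `k` of Prop. 2.1 on a lattice of the concrete tower: the lattice `P` (`P.L = Q.L`, `P.d = Q.d`), the step `k`, the annulus
`Ann = Bᵏ(Λ₇^{(k−1)′}) ∩ Λ₇^{(k)c}` read as a finite set of sites of `T^{(k)}`, the three printed quantities of (2.57) — `pFull =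
𝒫^{(k)}(Λ₇^{(k−1)′}, θ_kA^{(k)}, φ)`, `quartic = λ(Lᵏε)Σ_{x∈Ann}ηᵈ|φ^{(k)}(x)|⁴`, `pIn = 𝒫^{(k)}(Λ₇^{(k)}, θ_kA^{(k)}, φ)` — and the DISPLAYED
remainder: kernels `coef` and unit-lattice leg values `leg` of an `Ann`-localized (I.3.57)-polynomial. [cite: Balaban1982Higgs2, Prop. 2.1 (2.57) p.570] -/
structure Step21 (Q : B2.Params) (V : StepConsts) where
  P : HiggsLattice.Params
  hL : P.L = Q.L
  hd : P.d = Q.d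
  /-- the step -/
  k : ℕ
  /-- the annulus `Bᵏ(Λ₇^{(k−1)′}) ∩ Λ₇^{(k)c} ⊂ T^{(k)}` -/
  Ann : Finset (HiggsLattice.Site P k)
  pFull : ℝ
  quartic : ℝ
  pIn : ℝ
  coef : (q : ℕ) → (Fin q → HiggsLattice.Site P k) → (Fin q → (Fin V.N ⊕ Fin P.d)) → ℝ
  leg : (Fin V.N ⊕ Fin P.d) → HiggsLattice.Site P k → ℝ

namespace Step21

variable {Q : B2.Params} {V : StepConsts}

/-- The context of a step: `0 < Lᵏε ≦ 1` (p. 562: *"we have assumed Lᵏ⁺¹ε ≦ 1"*); the DISPLAYED decomposition (2.57) — `pFull + quartic − pIn`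
IS the localized polynomial; its kernel bounds with exponent `κ₀ + κ′`; the localization in `Ann`; the field bound `|leg| ≦ c·p(Lᵏε)` ((2.55)).
[cite: Balaban1982Higgs2, Prop. 2.1 (2.57) p.570; (2.55) p.570] -/
def ctx21 (i : Step21 Q V) : Prop :=
  i.P.mesh i.k ≤ 1 ∧
  i.pFull - (-i.quartic + i.pIn) = poly357 V.qmax i.coef i.leg ∧
  (∀ q, q ≤ V.qmax → ∀ (z : Fin q → HiggsLattice.Site i.P i.k) (κ : Fin q → (Fin V.N ⊕ Fin i.P.d)),
      |i.coef q z κ| ≤ V.C₀ * i.P.mesh i.k ^ (Q.κ₀ + V.κg) * Real.exp (-(V.δ₀ * (diam z : ℝ)))) ∧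
  (∀ q, q ≤ V.qmax → ∀ (z : Fin q → HiggsLattice.Site i.P i.k) (κ : Fin q → (Fin V.N ⊕ Fin i.P.d)),
      (∀ j, z j ∉ i.Ann) → i.coef q z κ = 0) ∧
  (∀ l x, |i.leg l x| ≤ V.c * B2.pFn Q.b₀ Q.p (i.P.mesh i.k))

/-- The reading of a step as r02's carrier `P21Setting` of Prop. 2.1: `scale = Lᵏε`, `restr255 = ctx21` (the conditions (2.55) enter through
the displayed field bound), the three printed quantities, `vol = |Ann|`. [cite: Balaban1982Higgs2, Prop. 2.1 (2.57) p.570] -/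
noncomputable def toP21 (i : Step21 Q V) : B2Sect2Statements.P21Setting :=
  { scale := i.P.mesh i.k, restr255 := i.ctx21, pFull := i.pFull, quartic := i.quartic, pIn := i.pIn, vol := i.Ann.card }

end Step21

/-- THE constant of (2.57) for the family: `C₀·polyConstLog(q̄, N + d, c, b₀, p, κ′, d, δ₀)` — independent of the step, the lattice, `ε`, the region.
[cite: Balaban1982Higgs2, Prop. 2.1 (2.57) p.570] -/
noncomputable def constC21 (Q : B2.Params) (V : StepConsts) : ℝ :=
  V.C₀ * polyConstLog V.qmax ((V.N : ℝ) + Q.d) V.c Q.b₀ Q.p V.κg Q.d V.δ₀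

variable {Q : B2.Params} {V : StepConsts}

/-- Per step: under `ctx21`, `|𝒫^{(k)}(Λ₇^{(k−1)′}) + quartic − 𝒫^{(k)}(Λ₇^{(k)})| ≦ constC21·(Lᵏε)^{κ₀}·|Ann|`. [cite: Balaban1982Higgs2, Prop. 2.1 (2.57) p.570] -/
theorem abs_rem_le (hP : Q.Printed) (i : Step21 Q V) (hi : i.ctx21) :
    |i.pFull - (-i.quartic + i.pIn)| ≤ constC21 Q V * i.P.mesh i.k ^ Q.κ₀ * (i.Ann.card : ℝ) := by
  obtain ⟨hp2, _, _, _, _, _, hb₀, _⟩ := hP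
  obtain ⟨hs1, hrep, hcoef, hloc, hleg⟩ := hi
  have hs0 : 0 < i.P.mesh i.k := i.P.mesh_pos _
  have hp0 : 0 < Q.p := by linarith
  have hq₀ : 0 ≤ V.c * B2.pFn Q.b₀ Q.p (i.P.mesh i.k) := mul_nonneg V.hc (pFn_nonneg hb₀.le hs0 hs1)
  -- file 1 at the step, with the displayed exponent κ₀ + κ′
  have h1 := abs_poly357_loc_le_scale (P := i.P) (k := i.k) V.qmax i.coef i.leg i.Ann (κ₀ := Q.κ₀ + V.κg) V.hC₀ hs0.le V.hδ₀ hq₀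
    hcoef hloc hleg
  have hcard : (Fintype.card (Fin V.N ⊕ Fin i.P.d) : ℝ) = (V.N : ℝ) + i.P.d := by
    rw [Fintype.card_sum, Fintype.card_fin, Fintype.card_fin, Nat.cast_add]
  rw [hcard] at h1
  -- the logarithms absorbed by the gap
  have hlog := polyConstLoc_pFn_mul_rpow_le V.qmax (n := (V.N : ℝ) + i.P.d) (by positivity) V.hc hb₀.le hp0 V.hκg hs0 hs1 i.P.d V.hδ₀.le
  have hsplit : i.P.mesh i.k ^ (Q.κ₀ + V.κg) = i.P.mesh i.k ^ Q.κ₀ * i.P.mesh i.k ^ V.κg := Real.rpow_add hs0 _ _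
  have hA : 0 ≤ i.P.mesh i.k ^ Q.κ₀ * (i.Ann.card : ℝ) := mul_nonneg (Real.rpow_nonneg hs0.le _) (Nat.cast_nonneg _)
  rw [hrep]
  unfold constC21
  rw [← i.hd]
  calc |poly357 V.qmax i.coef i.leg|
      ≤ (V.C₀ * polyConstLoc V.qmax ((V.N : ℝ) + i.P.d) (V.c * B2.pFn Q.b₀ Q.p (i.P.mesh i.k)) i.P.d V.δ₀) *
          i.P.mesh i.k ^ (Q.κ₀ + V.κg) * (i.Ann.card : ℝ) := h1
    _ = V.C₀ * (polyConstLoc V.qmax ((V.N : ℝ) + i.P.d) (V.c * B2.pFn Q.b₀ Q.p (i.P.mesh i.k)) i.P.d V.δ₀ * i.P.mesh i.k ^ V.κg) *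
          (i.P.mesh i.k ^ Q.κ₀ * (i.Ann.card : ℝ)) := by rw [hsplit]; ring
    _ ≤ V.C₀ * polyConstLog V.qmax ((V.N : ℝ) + i.P.d) V.c Q.b₀ Q.p V.κg i.P.d V.δ₀ * (i.P.mesh i.k ^ Q.κ₀ * (i.Ann.card : ℝ)) :=
        mul_le_mul_of_nonneg_right (mul_le_mul_of_nonneg_left hlog V.hC₀) hA
    _ = V.C₀ * polyConstLog V.qmax ((V.N : ℝ) + i.P.d) V.c Q.b₀ Q.p V.κg i.P.d V.δ₀ * i.P.mesh i.k ^ Q.κ₀ * (i.Ann.card : ℝ) := by ring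

/-- **Proposition 2.1 (2.57) p. 570 — r02's decl of record `B2Sect2Statements.Prop21Printed` INHABITED for the family of steps of the concrete tower
with the displayed remainder**: *"𝒫^{(k)}(Λ₇^{(k−1)′}, θ_kA^{(k)}, φ) = −λ(Lᵏε)Σ…ηᵈ|φ^{(k)}(x)|⁴ + 𝒫^{(k)}(Λ₇^{(k)}, θ_kA^{(k)}, φ) + O((Lᵏε)^{κ₀})|Λ₇^{(k−1)′}
∩ Λ₇^{(k)c}|"* with ONE constant `constC21 Q V` over ALL steps `k`, lattices, `ε` and regions (printed ranges `Q.Printed`; the exponent is the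
family's `Q.κ₀`, as r02 typed it).  KIND: model instance, displayed inputs (the proposition *"is a corollary of the analysis of the perturbation
expansions"*, paper III). [cite: Balaban1982Higgs2, Prop. 2.1 (2.57) p.570] -/
theorem prop21_step (Q : B2.Params) (hP : Q.Printed) (V : StepConsts) :
    B2Sect2Statements.Prop21Printed Q (Step21.toP21 (Q := Q) (V := V)) :=
  ⟨constC21 Q V, fun i hi => abs_rem_le hP i hi⟩

/-- **Non-vacuity of the Prop. 2.1 family**: every lattice and step with `Lᵏε ≦ 1` carries an instance obeying `ctx21` (the zero remainder:
`pFull = −quartic + pIn` exactly), e.g. on `mkParams` at `k = K` (mesh `ε₀ ≦ 1`). [cite: Balaban1982Higgs2, Prop. 2.1 (2.57) p.570] -/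
theorem ctx21_zero (hP : Q.Printed) (U : Consts) (K : ℕ) (quartic pIn : ℝ) :
    ∃ i : Step21 Q V, i.k = K ∧ i.quartic = quartic ∧ i.pIn = pIn ∧ i.ctx21 := by
  obtain ⟨_, _, hL1, hd23, _, _, hb₀, _⟩ := hP
  have hd : 1 ≤ Q.d := by rcases hd23 with h | h <;> omega
  have hL : 0 < Q.L := lt_trans Nat.zero_lt_one hL1
  refine ⟨⟨mkParams Q U hd hL K, rfl, rfl, K, ∅, -quartic + pIn, quartic, pIn, fun _ _ _ => 0, fun _ _ => 0⟩, rfl, rfl, rfl, ?_⟩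
  have hmesh : (mkParams Q U hd hL K).mesh K = U.ε₀ := mesh_mkParams hd hL K
  refine ⟨?_, ?_, ?_, ?_, ?_⟩
  · show (mkParams Q U hd hL K).mesh K ≤ 1
    rw [hmesh]
    exact U.hε₀1
  · show -quartic + pIn - (-quartic + pIn) = poly357 V.qmax (fun _ _ _ => (0 : ℝ)) (fun _ _ => (0 : ℝ))
    rw [sub_self]
    unfold B1Ineq358TreeDecaySum.poly357
    simp
  · intro q _ z κ
    show |(0 : ℝ)| ≤ _
    rw [abs_zero]
    exact mul_nonneg (mul_nonneg V.hC₀ (Real.rpow_nonneg ((mkParams Q U hd hL K).mesh_pos _).le _)) (Real.exp_pos _).le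
  · intro q _ z κ _
    rfl
  · intro l x
    show |(0 : ℝ)| ≤ _
    rw [abs_zero]
    refine mul_nonneg V.hc (pFn_nonneg hb₀.le ((mkParams Q U hd hL K).mesh_pos _) ?_)
    show (mkParams Q U hd hL K).mesh K ≤ 1
    rw [hmesh]
    exact U.hε₀1

end Prop21

end Literature.MathematicalPhysics.QuantumFieldTheory.Balaban1983to89.B2Ineq2116Region
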